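import Mathlib
import Literature.Analysis.FluidPDE.LocalTypeI
import Literature.Analysis.FluidPDE.SelfSimilar
import Literature.Analysis.FluidPDE.ScalingUniformRecurrence
import Literature.Analysis.FluidPDE.AxisymmetricEuler
import HarnessLib

/-!
# Sketch — crux-ideate `stmt-NavierStokesRegularity-1589` (RecurrentLiouville), ideator 2, round 1

First lemmas of the idea card `rung-neighbourhoods` (file `idea-rung-neighbourhoods.md`):
rigidity neighbourhoods of the two PROVED rungs (self-similar: Tsai 1998 Thm 2, tree
`tsai_selfsimilar_local_energy_holds`; axisymmetric: Seregin–Šverák 2009 Thm 3.1, named fact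
`AxisymmetricTypeIExclusion`) inside the compact Albritton–Barker Type-I class, in the exact
vocabulary of the crux. They need not be proved here; they must elaborate.
-/

namespace Summit.NavierStokesRegularity.NavierStokesRegularity.Cruxes.RecurrentLiouville.RungNeighbourhoods

open MeasureTheory Set Filter
open scoped ENNReal Topology

open Literature.Analysis.FluidPDE

/-- Local notation for physical space. -/
local notation "E3" => EuclideanSpace ℝ (Fin 3)

/-- The Albritton–Barker Type-I class of the crux with a UNIFORM bound `𝐈 ≤ M` (the compact
sub-family `𝒮(C, M)` on which Lin / A–B Lemma 2.2 compactness runs). -/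
def InClass (C : ℝ) (M : ℝ≥0∞) (u : ℝ → E3 → E3) (p : ℝ → E3 → ℝ)
    (G : ℝ → E3 → E3 →L[ℝ] E3) : Prop :=
  IsSuitableWeakSolutionOn (slab E3 (Iio 0) isOpen_Iio) 1 0 u p ∧
    HasWeakSpatialGradientOn (slab E3 (Iio 0) isOpen_Iio) u G ∧
    typeIBound (Iio (0 : ℝ) ×ˢ univ) u p G ≤ M ∧ HasTypeITimeDecay C u

/-- The unit closed backward cylinder `[-1, 0] × B̄₁` touching the singular time: the compact set
on which hull closeness is measured (closeness on every compact `K ⊆ {t ≤ 0}` follows by the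
exact scaling law `eLpNorm_nsRescale_restrict`). -/
def unitCyl : Set (ℝ × E3) := Icc (-1 : ℝ) 0 ×ˢ Metric.closedBall (0 : E3) 1

/-- `L³` distance of two space–time fields on the unit cylinder. -/
noncomputable def dist3 (v w : ℝ → E3 → E3) : ℝ≥0∞ :=
  eLpNorm (fun z : ℝ × E3 => v z.1 z.2 - w z.1 z.2) 3 (volume.restrict unitCyl)

/-- The field rotated about the `x₂`-axis by the angle `θ`: `(R_θ · u)(t, x) = R_θ u(t, R_{-θ} x)`. -/
noncomputable def rotField (θ : ℝ) (u : ℝ → E3 → E3) : ℝ → E3 → E3 :=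
  fun t x => rotZ θ (u t (rotZ (-θ) x))

/-- **First lemma (i): small-hull removal.** For every rate constant `C` and bound `M < ∞` there is
`δ > 0` such that a class profile whose WHOLE scaling orbit stays `δ`-close to it in
`L³([-1,0] × B̄₁)` — `‖u_{e^σ} − u‖_{L³} ≤ δ` for every log-scale `σ` — is regular at the
space–time origin. (Contains Chae–Wolf 2017 Thm 1.3 / Pineau–Vicol 2026 Thm 1.6 in the A–B class:
a `λ`-DSS profile with `λ` near `1` has orbit diameter `≤ 2 log λ · sup ‖∂_s U‖`; and the
Favard-gap criterion of the card.) Proof plan: contradiction sequence `δ_k → 0`;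
`SuitableCompactness_holds` + `PersistenceOfSingularities_holds` give a singular class limit
`u_∞` with `(u_∞)_λ = u_∞` for all `λ`, i.e. self-similar; Type-I ⇒ smooth ⇒ `IsLerayProfile`;
`tsai_selfsimilar_local_energy_holds` ⇒ `u_∞ = 0`, contradiction. -/
def SmallHullRemoval : Prop :=
  ∀ (C : ℝ) (M : ℝ≥0∞), M < ⊤ → ∃ δ : ℝ, 0 < δ ∧
    ∀ (u : ℝ → E3 → E3) (p : ℝ → E3 → ℝ) (G : ℝ → E3 → E3 →L[ℝ] E3),
      InClass C M u p G →
      (∀ σ : ℝ, dist3 (nsRescale (Real.exp σ) u) u ≤ ENNReal.ofReal δ) →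
      ¬ IsBackwardSingularPoint u 0

/-- **First lemma (ii): near-axisymmetric removal.** For every `C`, `M < ∞` there is `δ > 0` such
that a class profile which is `δ`-close in `L³([-1,0] × B̄₁)` to SOME field all of whose slices are
axisymmetric about the `x₂`-axis is regular at the origin. Proof plan: contradiction + compactness
(`SuitableCompactness_holds`, `PersistenceOfSingularities_holds`): the singular limit is a strong
`L³` limit of axisymmetric fields on the cylinder, hence axisymmetric there, and the LOCAL
Seregin–Šverák theorem (`Literature.Barriers.NavierStokesRegularity.AxisymmetricTypeIExclusion`,
hypotheses: `L³`/`L^{3/2}` on the cylinder + a.e. rate, all granted by the class) makes the origin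
regular — contradiction. -/
def NearAxisymmetricRemoval : Prop :=
  ∀ (C : ℝ) (M : ℝ≥0∞), M < ⊤ → ∃ δ : ℝ, 0 < δ ∧
    ∀ (u : ℝ → E3 → E3) (p : ℝ → E3 → ℝ) (G : ℝ → E3 → E3 →L[ℝ] E3),
      InClass C M u p G →
      (∃ a : ℝ → E3 → E3, (∀ t, IsAxisymmetric (a t)) ∧ dist3 u a ≤ ENNReal.ofReal δ) →
      ¬ IsBackwardSingularPoint u 0

/-- **First lemma (iii): rotational absorption (fast branch).** For every `C`, `M < ∞` there are
`ᾱ` and `δ > 0` such that: if the scaling orbit of a class profile is `δ`-shadowed on the unit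
cylinder by a one-parameter rotation of angular log-speed `α` with `|α| ≥ ᾱ` —
`‖R_{ασ} · u_{e^σ} − u‖_{L³} ≤ δ` for all `σ` — then the origin is regular. (Exact shadowing,
`δ = 0`, is the RSS ansatz; `|α| ≥ ᾱ` exact is Pineau–Vicol 2026 Thm 1.4, large-`α` half. Proof
plan: the shadowing at `σ = θ/α`, `|θ| ≤ π`, plus equicontinuity of `σ ↦ u_{e^σ}` at `σ = 0` on the
compact class makes `u` `(δ + o_ᾱ(1))`-close to its own azimuthal average, an axisymmetric field:
conclude by `NearAxisymmetricRemoval`.) The slow branch `|α| ≤ α_` lands in `SmallHullRemoval`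
the same way. -/
def RotationalAbsorptionFast : Prop :=
  ∀ (C : ℝ) (M : ℝ≥0∞), M < ⊤ → ∃ αbar δ : ℝ, 0 < δ ∧
    ∀ (α : ℝ), αbar ≤ |α| →
    ∀ (u : ℝ → E3 → E3) (p : ℝ → E3 → ℝ) (G : ℝ → E3 → E3 →L[ℝ] E3),
      InClass C M u p G →
      (∀ σ : ℝ, dist3 (rotField (α * σ) (nsRescale (Real.exp σ) u)) u ≤ ENNReal.ofReal δ) →
      ¬ IsBackwardSingularPoint u 0

/-- **Composition toward the crux (the settled sub-regimes).** A uniformly recurrent class profile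
(`IsScalingUniformlyRecurrent`, the crux hypothesis letter for letter) whose hull has diameter
`< δ(C,M)` is regular: immediate from `SmallHullRemoval` (recurrence is not even needed for this
branch — it is needed to PRODUCE small hulls: Favard's inequality for Kronecker hulls with a
spectral gap, see the card). Stated to record the exact interface with the crux. -/
theorem recurrent_smallHull_regular (h : SmallHullRemoval) (C : ℝ) (M : ℝ≥0∞) (hM : M < ⊤) :
    ∃ δ : ℝ, 0 < δ ∧ ∀ (u : ℝ → E3 → E3) (p : ℝ → E3 → ℝ) (G : ℝ → E3 → E3 →L[ℝ] E3),
      InClass C M u p G → IsScalingUniformlyRecurrent u →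
      (∀ σ : ℝ, dist3 (nsRescale (Real.exp σ) u) u ≤ ENNReal.ofReal δ) →
      ¬ IsBackwardSingularPoint u 0 := by
  obtain ⟨δ, hδ, H⟩ := h C M hM
  exact ⟨δ, hδ, fun u p G hcl _ hsmall => H u p G hcl hsmall⟩

end Summit.NavierStokesRegularity.NavierStokesRegularity.Cruxes.RecurrentLiouville.RungNeighbourhoods
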